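import Summits.HodgeConjecture.HodgeConjecture.Theorems.SecondaryPeriodsRiemannWeightOneStubAlgebraisationSmoothTransversal
import Summits.HodgeConjecture.HodgeConjecture.Theorems.SecondaryPeriodsRiemannWeightOneStubAlgebraisationSmoothLocalRegularity
import Literature.AlgebraicGeometry.Motives.SmoothPiecesByDimension
import HarnessLib

/-!
# Crux `RiemannWeightOne` (stmt-HodgeConjecture-16406), stub `stub_algebraisationSmooth`, part (G4): the local rings at complex points are regular

Helper file for the registered stub `stub_algebraisationSmooth` (Serre, GAGA §2 n°6 Prop. 3 and
Cor.: «`X` réduit, `X^h` une variété ⟹ `X` non singulier»). Setting of parts (G1)–(G3):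
`ι : X ↪ ℙ^{N'+1}_ℂ` a REDUCED closed subscheme, `M` a compact connected complex `n`-manifold,
`φ : M → X(ℂ)` an analytification, `F : M → ℙ(ℂ^{N'+2})` a holomorphic immersion with
`ι(ℂ) ∘ φ = projPoint ∘ F`.

* `LocalSmoothness.exists_eta` — **(C) compactness**: for the transversal finite projection `t` of
  part (G3), single-valued on `W ∋ m₀`, and `ℓ ∈ Γ(X, U₀)` whose value separates `φ m₀` in its
  `t`-fibre, complex points of `U₀` with `t`-coordinates and `ℓ`-value `η`-close to those of
  `φ m₀` lie in `φ(W)` (finite morphisms are proper on complex points, part (G2));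
* `LocalSmoothness.frequently_eval_ne_zero` — **density**: a non-zero `D ∈ ℂ[T]` does not vanish
  identically at `t(φ m)` near `m₀` (else the Zariski-closed `{D(t) = 0}` would have a preimage
  with interior in the connected `M`, part (I), forcing `D(t) = 0` in the reduced `X`, i.e. `D = 0`);
* `LocalSmoothness.isRegularLocalRing_stalk` — **the local ring `𝒪_{X, φ m₀}` is regular, of
  dimension `e ≥ n`**: parts (B) (`RootCounting.derivative_eval_ne_zero_of_branch`, whose
  hypotheses are the three items above and the continuity of the branch `ℓ ∘ φ`) and (A)
  (`LocalRegularity.isRegularLocalRing_of_branches`), transported from `B_𝔪` to the stalk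
  (Mathlib `IsAffineOpen.isLocalization_stalk`).

## References

* [SerreGAGA1956] J.-P. Serre, GAGA, Ann. Inst. Fourier 6 (1956), §2 n°6 Prop. 3 and Cor. 2.
* [SGA1] A. Grothendieck, M. Raynaud, SGA 1, Exp. XII Prop. 3.2 (v).
-/

noncomputable section

set_option linter.dupNamespace false

namespace Summit.HodgeConjecture.HodgeConjecture.Theorems.RiemannWeightOne

namespace LocalSmoothness

open scoped Manifold ContDiff Topology LinearAlgebra.Projectivization
open CategoryTheory AlgebraicGeometry Filter Set Function
open Literature.AlgebraicGeometry.Motives Literature.AlgebraicGeometry.Motives.AlgPoints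
open Literature.NumberTheory.Transcendental (IsAnalytification projPoint)
open Literature.AlgebraicGeometry.HodgeTheory
open AffineChart FiniteProjection Transversal

attribute [local instance] UniversalHyperplaneSection.sectionsAlgebra

variable {n : ℕ} {M : Type} [TopologicalSpace M] [ChartedSpace (Fin n → ℂ) M]
  {X : SchemeOver ℂ} {φ : M → ComplexPoints X} (hφ : IsAnalytification (Fin n → ℂ) X n φ)

/-! ### (C) Compactness: nearby fibre points with small `ℓ`-value lie in `φ(W)` -/

include hφ in
/-- **(C)** Let `Γ(X, U)` be integral over `ℂ[t]`, `W ∋ m₀` open, and `ℓ ∈ Γ(X, U)` such that the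
only complex point of `U` with the `t`-coordinates of `φ m₀` and the `ℓ`-value of `φ m₀` is `φ m₀`.
Then for some `η > 0`, every complex point of `U` whose `t`-coordinates and `ℓ`-value are `η`-close
to those of `φ m₀` lies in `φ(W)`: the points with `t`-coordinates `1`-close form a compact set
(part (G2)), on which the closed conditions "`η`-close and not in `φ(W)`" have empty intersection
over `η > 0`. [cite: SGA1, Exp. XII Prop. 3.2 (v)] -/
theorem exists_eta [LocallyOfFiniteType X.hom] [IsSeparated X.hom] (U : X.left.affineOpens) {e : ℕ}
    (t : Fin e → Γ(X.left, ↑U)) (hint : ∀ b : Γ(X.left, ↑U), IsIntegral (Algebra.adjoin ℂ (Set.range t)) b)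
    (ℓ : Γ(X.left, ↑U)) {m₀ : M} {W : Set M} (hWo : IsOpen W) (hm₀W : m₀ ∈ W)
    (hsep : ∀ (P : ComplexPoints X) (h : P.pt ∈ (↑U : X.left.Opens)),
      (fun k => P.eval ↑U h (t k)) = tupleMap φ U t m₀ →
        P.eval ↑U h ℓ = evalOrZero ↑U ℓ (φ m₀) → P = φ m₀) :
    ∃ η : ℝ, 0 < η ∧ ∀ (P : ComplexPoints X) (h : P.pt ∈ (↑U : X.left.Opens)),
      ‖(fun k => P.eval ↑U h (t k)) - tupleMap φ U t m₀‖ ≤ η →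
        ‖P.eval ↑U h ℓ - evalOrZero ↑U ℓ (φ m₀)‖ ≤ η → P ∈ φ '' W := by
  haveI : T2Space (ComplexPoints X) := ComplexPoints.t2Space_of_isSeparated X
  set a := tupleMap φ U t m₀ with ha
  set l₀ := evalOrZero ↑U ℓ (φ m₀) with hl₀
  -- the compact set of points with `t`-coordinates `1`-close
  set K : Set (ComplexPoints X) := {P | ∃ h : P.pt ∈ (↑U : X.left.Opens),
    (fun k => P.eval ↑U h (t k)) ∈ Metric.closedBall a 1} with hK
  have hKc : IsCompact K := isCompact_setOf_eval_mem U t hint (isCompact_closedBall a 1)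
  have hKU : K ⊆ {P | P.pt ∈ (↑U : X.left.Opens)} := fun P ⟨h, _⟩ => h
  -- the total functions `(t, ℓ)` are continuous on `U(ℂ)`
  set f : ComplexPoints X → (Fin e → ℂ) × ℂ := fun P => (fun k => evalOrZero ↑U (t k) P, evalOrZero ↑U ℓ P)
    with hf
  have hfc : ContinuousOn f {P | P.pt ∈ (↑U : X.left.Opens)} :=
    (AlgPoints.continuousOn_evalOrZero_pi t).prodMk (AlgPoints.continuousOn_evalOrZero _ ℓ)
  have hφW : IsOpen (φ '' W) := hφ.homeomorph.isOpenMap W hWo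
  -- the closed family
  set Z : {η : ℝ // 0 < η} → Set (ComplexPoints X) := fun η =>
    K ∩ f ⁻¹' (Metric.closedBall a η ×ˢ Metric.closedBall l₀ η) ∩ (φ '' W)ᶜ with hZ
  have hZc : ∀ η, IsClosed (Z η) := fun η =>
    ((hfc.mono hKU).preimage_isClosed_of_isClosed hKc.isClosed
      (Metric.isClosed_closedBall.prod Metric.isClosed_closedBall)).inter hφW.isClosed_compl
  have hdir : Directed (· ⊇ ·) Z := by
    intro η₁ η₂
    refine ⟨⟨min η₁.1 η₂.1, lt_min η₁.2 η₂.2⟩, ?_, ?_⟩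
    · rintro P ⟨⟨hPK, hPf⟩, hPW⟩
      exact ⟨⟨hPK, ⟨Metric.closedBall_subset_closedBall (min_le_left _ _) hPf.1,
        Metric.closedBall_subset_closedBall (min_le_left _ _) hPf.2⟩⟩, hPW⟩
    · rintro P ⟨⟨hPK, hPf⟩, hPW⟩
      exact ⟨⟨hPK, ⟨Metric.closedBall_subset_closedBall (min_le_right _ _) hPf.1,
        Metric.closedBall_subset_closedBall (min_le_right _ _) hPf.2⟩⟩, hPW⟩
  -- with empty intersection
  have hempty : K ∩ ⋂ η, Z η = ∅ := by
    refine Set.eq_empty_iff_forall_notMem.2 fun P ⟨hPK, hP⟩ => ?_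
    rw [Set.mem_iInter] at hP
    obtain ⟨hU, -⟩ := hPK
    have h1 : f P = (a, l₀) := by
      refine Prod.ext ?_ ?_
      · refine eq_of_forall_dist_le fun η hη => ?_
        exact (hP ⟨η, hη⟩).1.2.1
      · refine eq_of_forall_dist_le fun η hη => ?_
        exact (hP ⟨η, hη⟩).1.2.2
    have h1a : (fun k => evalOrZero ↑U (t k) P) = a := congrArg Prod.fst h1
    have h1b : evalOrZero ↑U ℓ P = l₀ := congrArg Prod.snd h1
    have ht : (fun k => P.eval ↑U hU (t k)) = a := by
      rw [← h1a]
      funext k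
      exact (evalOrZero_of_mem _ hU).symm
    have hℓ : P.eval ↑U hU ℓ = l₀ := by
      rw [← h1b]
      exact (evalOrZero_of_mem _ hU).symm
    have hPeq := hsep P hU ht hℓ
    exact (hP ⟨1, one_pos⟩).2 ⟨m₀, hm₀W, hPeq.symm⟩
  haveI : Nonempty {η : ℝ // 0 < η} := ⟨⟨1, one_pos⟩⟩
  obtain ⟨⟨η₀, hη₀⟩, hη₀e⟩ := hKc.elim_directed_family_closed Z hZc hempty hdir
  refine ⟨min η₀ 1, lt_min hη₀ one_pos, fun P h htP hℓP => ?_⟩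
  by_contra hPW
  have hPK : P ∈ K := ⟨h, Metric.mem_closedBall.2 (by
    rw [dist_eq_norm]; exact htP.trans (min_le_right _ _))⟩
  have hfP : f P ∈ Metric.closedBall a η₀ ×ˢ Metric.closedBall l₀ η₀ := by
    refine ⟨Metric.mem_closedBall.2 ?_, Metric.mem_closedBall.2 ?_⟩
    · rw [dist_eq_norm]
      have : (fun k => evalOrZero ↑U (t k) P) = fun k => P.eval ↑U h (t k) :=
        funext fun k => evalOrZero_of_mem _ h
      rw [show (f P).1 = fun k => evalOrZero ↑U (t k) P from rfl, this]
      exact htP.trans (min_le_left _ _)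
    · rw [dist_eq_norm, show (f P).2 = evalOrZero ↑U ℓ P from rfl, evalOrZero_of_mem _ h]
      exact hℓP.trans (min_le_left _ _)
  have : P ∈ K ∩ Z ⟨η₀, hη₀⟩ := ⟨hPK, ⟨hPK, hfP⟩, hPW⟩
  rw [hη₀e] at this
  exact this

include hφ in
/-- **(C) in filter form.** With `η` as in `exists_eta` and `t ∘ φ` injective on `W`: for `m` near
`m₀`, every `ℂ`-algebra map `ψ : Γ(X, U) → ℂ` with the `t`-values of `φ m` and `ℓ`-value `η`-close
to that of `φ m₀` has `ℓ`-value exactly `ℓ(φ m)`. [folklore] -/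
theorem eventually_unique [LocallyOfFiniteType X.hom] [IsSeparated X.hom] (U : X.left.affineOpens)
    {e : ℕ} (t : Fin e → Γ(X.left, ↑U))
    (hint : ∀ b : Γ(X.left, ↑U), IsIntegral (Algebra.adjoin ℂ (Set.range t)) b)
    (ℓ : Γ(X.left, ↑U)) {m₀ : M} (hm₀ : (φ m₀).pt ∈ (↑U : X.left.Opens)) {W : Set M}
    (hWo : IsOpen W) (hm₀W : m₀ ∈ W) (hinj : InjOn (tupleMap φ U t) W)
    (hsep : ∀ (P : ComplexPoints X) (h : P.pt ∈ (↑U : X.left.Opens)),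
      (fun k => P.eval ↑U h (t k)) = tupleMap φ U t m₀ →
        P.eval ↑U h ℓ = evalOrZero ↑U ℓ (φ m₀) → P = φ m₀) :
    ∃ η : ℝ, 0 < η ∧ ∀ᶠ m in 𝓝 m₀, ∀ ψ : Γ(X.left, ↑U) →ₐ[ℂ] ℂ,
      (fun k => ψ (t k)) = tupleMap φ U t m →
        ‖ψ ℓ - evalOrZero ↑U ℓ (φ m₀)‖ < η → ψ ℓ = evalOrZero ↑U ℓ (φ m) := by
  obtain ⟨η, hη, hclose⟩ := exists_eta hφ U t hint ℓ hWo hm₀W hsep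
  refine ⟨η, hη, ?_⟩
  have hev : ∀ᶠ m in 𝓝 m₀, m ∈ W ∧ ‖tupleMap φ U t m - tupleMap φ U t m₀‖ < η := by
    refine (hWo.eventually_mem hm₀W).and ?_
    have h := (Metric.tendsto_nhds.1 (continuousAt_tupleMap hφ U t hm₀)) η hη
    simpa only [dist_eq_norm] using h
  filter_upwards [hev] with m hm ψ hψt hψℓ
  have hPU := pt_pointOf_mem U ψ
  have hPt : (fun k => (pointOf U ψ).eval ↑U hPU (t k)) = tupleMap φ U t m := by
    rw [← hψt]; funext k; exact eval_pointOf U ψ _ _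
  have hPW : pointOf U ψ ∈ φ '' W := by
    refine hclose (pointOf U ψ) hPU ?_ ?_
    · rw [hPt]; exact hm.2.le
    · rw [eval_pointOf]; exact hψℓ.le
  obtain ⟨m', hm'W, hm'P⟩ := hPW
  have hmm' : m' = m := hinj hm'W hm.1 (by
    change (fun k => evalOrZero ↑U (t k) (φ m')) = _
    rw [hm'P, ← hPt]
    funext k
    exact evalOrZero_of_mem _ hPU)
  rw [← hmm', hm'P, evalOrZero_pointOf]

/-! ### Density: non-zero polynomials in `t` do not vanish near `m₀` along `φ` -/

include hφ in
/-- **Density.** For `X` reduced, `M` connected and `ℂ[T] → Γ(X, U)`, `T ↦ t`, injective, a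
non-zero `D ∈ ℂ[T]` has `D(t(φ m)) ≠ 0` for `m` arbitrarily close to `m₀`: otherwise the regular
function `D(t)` vanishes at `φ m` for `m` near `m₀`, the preimage of the Zariski-closed set
`X ∖ D(D(t))` has an interior point, so it is everything (part (I),
`eq_univ_of_interior_preimage_nonempty`), `D(D(t)) = ∅`, `D(t) = 0` (`X` reduced), `D = 0`.
[cite: SerreGAGA1956, §2 n°5 Lemme 1 b)] -/
theorem frequently_eval_ne_zero [LocallyOfFiniteType X.hom] [IsReduced X.left] [ConnectedSpace M]
    [IsManifold 𝓘(ℂ, Fin n → ℂ) ω M] (U : X.left.affineOpens) {e : ℕ} (t : Fin e → Γ(X.left, ↑U))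
    (hinj : Injective (MvPolynomial.aeval t : MvPolynomial (Fin e) ℂ →ₐ[ℂ] Γ(X.left, ↑U)))
    {m₀ : M} (hm₀ : (φ m₀).pt ∈ (↑U : X.left.Opens)) (D : MvPolynomial (Fin e) ℂ) (hD : D ≠ 0) :
    ∃ᶠ m in 𝓝 m₀, MvPolynomial.eval (tupleMap φ U t m) D ≠ 0 := by
  by_contra hnot
  rw [Filter.not_frequently] at hnot
  simp only [not_not] at hnot
  set f : Γ(X.left, ↑U) := MvPolynomial.aeval t D with hf
  -- `D(t(φ m)) = f(φ m)` on `U(ℂ)`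
  have hval : ∀ m (hm : (φ m).pt ∈ (↑U : X.left.Opens)),
      MvPolynomial.eval (tupleMap φ U t m) D = (φ m).eval ↑U hm f := by
    intro m hm
    rw [hf, ← evalAlgHom_apply U (φ m) hm, ← AlgHom.comp_apply, MvPolynomial.comp_aeval,
      tupleMap_apply_of_mem U t hm]
    rfl
  -- the closed set `Z = X ∖ D(f)` has a preimage with non-empty interior
  set Z : Set X.left := ((X.left.basicOpen f : X.left.Opens) : Set X.left)ᶜ with hZ
  have hZc : IsClosed Z := (X.left.basicOpen f).isOpen.isClosed_compl
  have hint : (interior (φ ⁻¹' {P : ComplexPoints X | P.pt ∈ Z})).Nonempty := by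
    refine ⟨m₀, mem_interior_iff_mem_nhds.2 ?_⟩
    filter_upwards [hnot, (hφ.isOpen_preimage ↑U).mem_nhds hm₀] with m hm hmU
    change (φ m).pt ∉ X.left.basicOpen f
    rw [AlgPoints.pt_mem_basicOpen_iff (φ m) hmU f, not_not, ← hval m hmU]
    exact hm
  have hZu := eq_univ_of_interior_preimage_nonempty hφ hZc hint
  -- so `D(f) = ∅`, `f = 0`, `D = 0`
  have hbot : X.left.basicOpen f = ⊥ := by
    refine TopologicalSpace.Opens.ext ?_
    rw [TopologicalSpace.Opens.coe_bot, ← Set.compl_univ, ← hZu, hZ, compl_compl]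
  have hf0 : f = 0 := (AlgebraicGeometry.basicOpen_eq_bot_iff f).1 hbot
  exact hD (hinj (by rw [map_zero]; exact hf0))

/-! ### The local ring at `φ m₀` is regular -/

section Main

variable {N' : ℕ} (ι : X ⟶ projectiveSpace (N' + 1) ℂ) [IsClosedImmersion ι.left]
  (F : M → ℙ ℂ (Fin (N' + 2) → ℂ)) (hcomp : ∀ m, AlgPoints.map ι (φ m) = projPoint (N' + 1) (F m))

include hφ in
/-- **The branch of a separating `ℓ ∈ 𝔪` is simple** (the hypotheses of part (B) verified): with
`t` integral coordinates on the affine open `U ∋ φ m₀`, `ℂ[T] → Γ(X, U)` injective, `t ∘ φ`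
injective on the open `W ∋ m₀`, and `ℓ` vanishing at `φ m₀` and separating `φ m₀` from the other
points with the same `t`-coordinates, the minimal polynomial `G` of `ℓ` over `ℂ[T]` has
`∂G/∂Y(t(φ m₀), 0) ≠ 0`. [cite: SerreGAGA1956, §2 n°6 Prop. 3 and Cor. 2] -/
theorem exists_simple_branch [LocallyOfFiniteType X.hom] [IsSeparated X.hom] [IsReduced X.left]
    [ConnectedSpace M] [IsManifold 𝓘(ℂ, Fin n → ℂ) ω M] (U : X.left.affineOpens) {e : ℕ}
    (t : Fin e → Γ(X.left, ↑U)) [IsDomain Γ(X.left, ↑U)]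
    [Algebra (MvPolynomial (Fin e) ℂ) Γ(X.left, ↑U)] [IsScalarTower ℂ (MvPolynomial (Fin e) ℂ) Γ(X.left, ↑U)]
    [Module.IsTorsionFree (MvPolynomial (Fin e) ℂ) Γ(X.left, ↑U)]
    [Algebra.IsIntegral (MvPolynomial (Fin e) ℂ) Γ(X.left, ↑U)]
    (halg : ∀ r, algebraMap (MvPolynomial (Fin e) ℂ) Γ(X.left, ↑U) r = MvPolynomial.aeval t r)
    (ht : ∀ b : Γ(X.left, ↑U), IsIntegral (Algebra.adjoin ℂ (Set.range t)) b)
    (hinj : Injective (MvPolynomial.aeval t : MvPolynomial (Fin e) ℂ →ₐ[ℂ] Γ(X.left, ↑U)))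
    {m₀ : M} (hm₀ : (φ m₀).pt ∈ (↑U : X.left.Opens)) {W : Set M} (hWo : IsOpen W) (hm₀W : m₀ ∈ W)
    (hinjW : InjOn (tupleMap φ U t) W)
    (ℓ : Γ(X.left, ↑U)) (hℓ : evalAlgHom U (φ m₀) hm₀ ℓ = 0)
    (hsepψ : ∀ ψ : Γ(X.left, ↑U) →ₐ[ℂ] ℂ, RootCounting.coords (d := e) ψ =
      RootCounting.coords (d := e) (evalAlgHom U (φ m₀) hm₀) → ψ ℓ = 0 → ψ = evalAlgHom U (φ m₀) hm₀) :
    ∃ G : Polynomial (MvPolynomial (Fin e) ℂ), Polynomial.aeval ℓ G = 0 ∧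
      ((G.map (MvPolynomial.eval (RootCounting.coords (d := e) (evalAlgHom U (φ m₀) hm₀)))).derivative).eval 0 ≠ 0 := by
  have hcoords : ∀ ψ : Γ(X.left, ↑U) →ₐ[ℂ] ℂ, RootCounting.coords (d := e) ψ = fun k => ψ (t k) :=
    fun ψ => funext fun k => by simp only [RootCounting.coords, halg, MvPolynomial.aeval_X]
  have he₀t : (fun k => evalAlgHom U (φ m₀) hm₀ (t k)) = tupleMap φ U t m₀ := by
    rw [tupleMap_apply_of_mem U t hm₀]; rfl
  have he₀ℓ : ∀ b, evalAlgHom U (φ m₀) hm₀ b = evalOrZero ↑U b (φ m₀) :=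
    fun b => (evalOrZero_of_mem b hm₀).symm
  refine ⟨minpoly (MvPolynomial (Fin e) ℂ) ℓ, minpoly.aeval _ ℓ, ?_⟩
  -- separation on complex points
  have hsepP : ∀ (P : ComplexPoints X) (h : P.pt ∈ (↑U : X.left.Opens)),
      (fun k => P.eval ↑U h (t k)) = tupleMap φ U t m₀ →
        P.eval ↑U h ℓ = evalOrZero ↑U ℓ (φ m₀) → P = φ m₀ := by
    intro P h hPt hPℓ
    have hψ : evalAlgHom U P h = evalAlgHom U (φ m₀) hm₀ := by
      refine hsepψ _ ?_ ?_
      · rw [hcoords, hcoords, he₀t, ← hPt]; rfl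
      · rw [evalAlgHom_apply, hPℓ, ← he₀ℓ]; exact hℓ
    rw [← pointOf_evalAlgHom U P h, hψ, pointOf_evalAlgHom]
  -- the hypotheses of part (B)
  have hτ : ContinuousAt (tupleMap φ U t) m₀ := continuousAt_tupleMap hφ U t hm₀
  have hlam : ContinuousAt (fun m => evalOrZero ↑U ℓ (φ m)) m₀ :=
    ((AlgPoints.continuousOn_evalOrZero _ ℓ).comp hφ.isHomeomorph.continuous.continuousOn
      (fun _ h => h)).continuousAt ((hφ.isOpen_preimage ↑U).mem_nhds hm₀)
  have hbr : ∀ᶠ m in 𝓝 m₀, ∃ ψ : Γ(X.left, ↑U) →ₐ[ℂ] ℂ,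
      RootCounting.coords (d := e) ψ = tupleMap φ U t m ∧ ψ ℓ = evalOrZero ↑U ℓ (φ m) := by
    filter_upwards [(hφ.isOpen_preimage ↑U).mem_nhds hm₀] with m hm
    refine ⟨evalAlgHom U (φ m) hm, ?_, ?_⟩
    · rw [hcoords, tupleMap_apply_of_mem U t hm]; rfl
    · rw [evalAlgHom_apply]; exact (evalOrZero_of_mem ℓ hm).symm
  have hde : ∀ D : MvPolynomial (Fin e) ℂ, D ≠ 0 →
      ∃ᶠ m in 𝓝 m₀, MvPolynomial.eval (tupleMap φ U t m) D ≠ 0 :=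
    fun D hD => frequently_eval_ne_zero hφ U t hinj hm₀ D hD
  obtain ⟨η, hη, hun⟩ := eventually_unique hφ U t ht ℓ hm₀ hWo hm₀W hinjW hsepP
  have hun' : ∃ η : ℝ, 0 < η ∧ ∀ᶠ m in 𝓝 m₀, ∀ ψ : Γ(X.left, ↑U) →ₐ[ℂ] ℂ,
      RootCounting.coords (d := e) ψ = tupleMap φ U t m →
        ‖ψ ℓ - evalOrZero ↑U ℓ (φ m₀)‖ < η → ψ ℓ = evalOrZero ↑U ℓ (φ m) := by
    refine ⟨η, hη, ?_⟩
    filter_upwards [hun] with m hm ψ hψ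
    exact hm ψ (by rw [← hcoords]; exact hψ)
  have hB := RootCounting.derivative_eval_ne_zero_of_branch ℓ m₀ (tupleMap φ U t)
    (fun m => evalOrZero ↑U ℓ (φ m)) hτ hlam hbr hde hun'
  have h0 : evalOrZero ↑U ℓ (φ m₀) = 0 := by rw [← he₀ℓ]; exact hℓ
  rw [h0] at hB
  rwa [hcoords, he₀t]

include hφ hcomp in
/-- **The local ring `𝒪_{X, φ m₀}` is regular of dimension `e ≥ n`** for `X` reduced and `M`
connected, at every point `m₀` where `F` is differentiable with injective differential: the
transversal finite projection `t` of part (G3) makes every `ℓ ∈ 𝔪` separating `φ m₀` in its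
`t`-fibre a single-valued continuous branch near `m₀`, hence (part (B), with the density and
compactness inputs of this file) `∂G_ℓ/∂Y ≠ 0` at `(t(φ m₀), 0)`, and part (A) concludes.
[cite: SerreGAGA1956, §2 n°6 Prop. 3 and Cor. 2] -/
theorem isRegularLocalRing_stalk [IsReduced X.left] [ConnectedSpace M] [IsManifold 𝓘(ℂ, Fin n → ℂ) ω M]
    (m₀ : M) (hFd : MDifferentiableAt 𝓘(ℂ, Fin n → ℂ) 𝓘(ℂ, Fin (N' + 1) → ℂ) F m₀)
    (hdF : Injective (mfderiv 𝓘(ℂ, Fin n → ℂ) 𝓘(ℂ, Fin (N' + 1) → ℂ) F m₀)) :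
    IsRegularLocalRing (X.left.presheaf.stalk (φ m₀).pt) ∧
      ∃ e : ℕ, n ≤ e ∧ ringKrullDim (X.left.presheaf.stalk (φ m₀).pt) = e := by
  classical
  haveI := Transversal.locallyOfFiniteType ι
  haveI : IsProper X.hom := by rw [← Over.w ι]; infer_instance
  haveI : IsSeparated X.hom := inferInstance
  obtain ⟨e, t, hne, ht, hinj, -, W, hWo, hm₀W, -, hinjW⟩ :=
    exists_transversal_projection ι hφ F hcomp m₀ hFd hdF
  have hm₀ : (φ m₀).pt ∈ (↑(affineOpenAt ι F m₀) : X.left.Opens) := pt_mem_affineOpenAt ι F hcomp m₀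
  -- the algebra `B = Γ(X, U₀)` over `R = ℂ[T]` through `t`
  haveI : IsDomain Γ(X.left, ↑(affineOpenAt ι F m₀)) := isDomain_sections ι hφ F hcomp m₀
  haveI : Algebra.FiniteType ℂ Γ(X.left, ↑(affineOpenAt ι F m₀)) := finiteType_sections _
  letI algRB : Algebra (MvPolynomial (Fin e) ℂ) Γ(X.left, ↑(affineOpenAt ι F m₀)) :=
    (MvPolynomial.aeval t : MvPolynomial (Fin e) ℂ →ₐ[ℂ] Γ(X.left, ↑(affineOpenAt ι F m₀))).toRingHom.toAlgebra
  have halg : ∀ r, algebraMap (MvPolynomial (Fin e) ℂ) Γ(X.left, ↑(affineOpenAt ι F m₀)) r = MvPolynomial.aeval t r :=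
    fun r => rfl
  haveI : IsScalarTower ℂ (MvPolynomial (Fin e) ℂ) Γ(X.left, ↑(affineOpenAt ι F m₀)) :=
    IsScalarTower.of_algebraMap_eq fun c => by
      rw [halg]; exact ((MvPolynomial.aeval t).commutes c).symm
  haveI : Algebra.IsIntegral (MvPolynomial (Fin e) ℂ) Γ(X.left, ↑(affineOpenAt ι F m₀)) :=
    ⟨fun b => isIntegral_aeval_of_forall_isIntegral t ht b⟩
  haveI : Module.IsTorsionFree (MvPolynomial (Fin e) ℂ) Γ(X.left, ↑(affineOpenAt ι F m₀)) := by
    refine Module.isTorsionFree_iff_smul_eq_zero.2 fun r b h => ?_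
    rw [Algebra.smul_def, mul_eq_zero, halg] at h
    rcases h with h | h
    · exact Or.inl (hinj (by rw [map_zero]; exact h))
    · exact Or.inr h
  have hcoords : ∀ ψ : Γ(X.left, ↑(affineOpenAt ι F m₀)) →ₐ[ℂ] ℂ, RootCounting.coords (d := e) ψ = fun k => ψ (t k) :=
    fun ψ => funext fun k => by
      simp only [RootCounting.coords, halg, MvPolynomial.aeval_X]
  -- the point `e₀` and its maximal ideal
  set e₀ : Γ(X.left, ↑(affineOpenAt ι F m₀)) →ₐ[ℂ] ℂ := evalAlgHom (affineOpenAt ι F m₀) (φ m₀) hm₀ with he₀def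
  set 𝔪 := ((affineOpenAt ι F m₀).2.primeIdealOf ⟨(φ m₀).pt, hm₀⟩).asIdeal with h𝔪
  have hker : RingHom.ker (e₀ : Γ(X.left, ↑(affineOpenAt ι F m₀)) →+* ℂ) = 𝔪 := by
    -- adapted from `Motives.ringKrullDim_stalk_eq_of_isStandardSmoothOfRelativeDimension`
    ext b
    rw [RingHom.mem_ker, h𝔪, ← not_iff_not,
      ← Literature.AlgebraicGeometry.Motives.mem_basicOpen_iff_notMem_primeIdealOf' (affineOpenAt ι F m₀).2 ⟨(φ m₀).pt, hm₀⟩ b]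
    exact (AlgPoints.pt_mem_basicOpen_iff (φ m₀) hm₀ b).symm
  have hsurj : Surjective e₀ := fun c => ⟨algebraMap ℂ _ c, e₀.commutes c⟩
  haveI : 𝔪.IsMaximal := by
    rw [← hker]; exact RingHom.ker_isMaximal_of_surjective (e₀ : Γ(X.left, ↑(affineOpenAt ι F m₀)) →+* ℂ) hsurj
  -- finiteness of the fibre
  have hfin : {ψ : Γ(X.left, ↑(affineOpenAt ι F m₀)) →ₐ[ℂ] ℂ | RootCounting.coords (d := e) ψ = RootCounting.coords (d := e) e₀}.Finite := by
    simp_rw [hcoords]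
    exact finite_fibre_algHom (affineOpenAt ι F m₀) t ht _
  -- the branches (part (B) for separating elements of `𝔪`)
  have hbranch := fun ℓ hℓ hsepψ =>
    exists_simple_branch hφ (affineOpenAt ι F m₀) t halg ht hinj hm₀ hWo hm₀W hinjW ℓ hℓ hsepψ
  -- part (A)
  obtain ⟨hreg, hdimL⟩ := LocalRegularity.isRegularLocalRing_of_branches 𝔪 e₀ hker hfin hbranch
  -- transport to the stalk
  letI := TopCat.Presheaf.algebra_section_stalk X.left.presheaf (⟨(φ m₀).pt, hm₀⟩ : (↑(affineOpenAt ι F m₀) : X.left.Opens))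
  haveI hloc : IsLocalization.AtPrime (X.left.presheaf.stalk (φ m₀).pt) 𝔪 :=
    (affineOpenAt ι F m₀).2.isLocalization_stalk ⟨(φ m₀).pt, hm₀⟩
  have eqv : Localization.AtPrime 𝔪 ≃+* X.left.presheaf.stalk (φ m₀).pt :=
    (IsLocalization.algEquiv 𝔪.primeCompl (Localization.AtPrime 𝔪)
      (X.left.presheaf.stalk (φ m₀).pt)).toRingEquiv
  exact ⟨IsRegularLocalRing.of_ringEquiv eqv, e, hne, by rw [← ringKrullDim_eq_of_ringEquiv eqv, hdimL]⟩

end Main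

end LocalSmoothness

open scoped Manifold ContDiff LinearAlgebra.Projectivization in
open CategoryTheory AlgebraicGeometry Literature.AlgebraicGeometry.Motives
  Literature.NumberTheory.Transcendental in
/-- **Registered sub-goal `stub_algebraisationSmooth_localSmoothness`** of the stub
`stub_algebraisationSmooth` (part (G4), `LocalSmoothness.isRegularLocalRing_stalk`).
[cite: SerreGAGA1956, §2 n°6 Prop. 3 and Cor. 2] -/
theorem stub_algebraisationSmooth_localSmoothness :
    ∀ ⦃n N' : ℕ⦄ ⦃M : Type⦄ [TopologicalSpace M] [ChartedSpace (Fin n → ℂ) M]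
      [IsManifold 𝓘(ℂ, Fin n → ℂ) ω M] [ConnectedSpace M] ⦃X : SchemeOver ℂ⦄
      (ι : X ⟶ projectiveSpace (N' + 1) ℂ) [IsClosedImmersion ι.left] [IsReduced X.left]
      ⦃φ : M → ComplexPoints X⦄ (hφ : IsAnalytification (Fin n → ℂ) X n φ)
      (F : M → ℙ ℂ (Fin (N' + 2) → ℂ)) (hcomp : ∀ m, AlgPoints.map ι (φ m) = projPoint (N' + 1) (F m))
      (m₀ : M), MDifferentiableAt 𝓘(ℂ, Fin n → ℂ) 𝓘(ℂ, Fin (N' + 1) → ℂ) F m₀ →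
      Function.Injective (mfderiv 𝓘(ℂ, Fin n → ℂ) 𝓘(ℂ, Fin (N' + 1) → ℂ) F m₀) →
      IsRegularLocalRing (X.left.presheaf.stalk (φ m₀).pt) ∧
        ∃ e : ℕ, n ≤ e ∧ ringKrullDim (X.left.presheaf.stalk (φ m₀).pt) = e :=
  fun _ _ _ _ _ _ _ _ ι _ _ _ hφ F hcomp m₀ hFd hdF =>
    LocalSmoothness.isRegularLocalRing_stalk hφ ι F hcomp m₀ hFd hdF

end Summit.HodgeConjecture.HodgeConjecture.Theorems.RiemannWeightOne

end
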